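import Summits.CriticalPhenomena.PercolationContinuityZ3.Theorems.PercNearOneGluingNoHeavyLowerTailSahiC4CubeColourCheck

/-!
# Sahi's `C₄` on the cube `{0,1}^m` by 4-COLOURED ANTICHAINS, II: from the certificate to `E₄ ≥ 0` for increasing events under every product
# measure

Support file (cell `prim-sahi`, seat `prim-sahi-typer` gen 28; `--supports stmt-CriticalPhenomena-4575`).  Pure proofs, standard axioms; continues
…`SahiC4CubeColourCheck` (the checker `colourCheck4 m σ`, its completeness up to relabelling `leafT4_of_colourCheck4`).

* `encA_colourMember4` — the bitmask of a co-generated member `{S | ∀ T ∈ N, c T = i → ¬ S ⊆ T}` is the checker's mask;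
* `coMember4_eq_univ_of_downMask4_eq_zero` — an empty colour class generates the whole cube;
* `sahiE4_coMember_nonneg_of_leafT4` — a passing leaf gives `E₄ ≥ 0` on the co-generated quadruple (empty class: `E₄(·,·,·,Ω) = 2E₃ ≥ 0` by
  `C₃(μ_p)`; else prim-masterthm-p3's `sahiE4_nonneg_of_checkQuad`);
* `sahiE_four_colouring_nonneg_of_colourCheck4` — the coloured-antichain core at order `4` in weight form (relabelling undone by the symmetry
  `sahiE_comp_perm`, then `sahiE_four_ind`);
* `sahiPositive_four_of_colourCheck4` — `SahiPositive (bernoulliWeight p) 4` by the value-level saturation `SahiAbsorbed.sahiPositive_of_colouring`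
  (`C₁`, `C₂` = FKG, `C₃(μ_p)` from the hypothesis by layer cake `sahiPositive_three_of_events`);
* **`sahiE4_nonneg_of_colourCheck4`**: `colourCheck4 m σ = true →` `C₃(μ_p)` on `{0,1}^m` `→` for all increasing `A, B, C, D ⊆ Set (Fin m)`,
  `0 ≤ E₄(A,B,C,D)` under `prodBernoulli p`. [this work]
-/

namespace Summit.CriticalPhenomena.PercolationContinuityZ3.Theorems.SahiC4Cube

open Finset MeasureTheory OneCutCert CovTransferCert FourCopyCert SahiC3Cube
open Literature.Combinatorics.Sahi2008
open Literature.Probability.LatticeModels (prodBernoulli sahiE3 sahiE4 sahiE4_univ sahiE4_comm₁₂)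
open Literature.Probability.Percolation
open Literature.Probability.Percolation.DecisionTree (ind ind_nonneg)

/-! ## From points-as-numbers to events of `Set (Fin m)` -/

section Events

open Classical

/-- **The bitmask of a co-generated member is the checker's mask** (four colours). [this work] -/
theorem encA_colourMember4 {m : ℕ} (N : Finset (Set (Fin m))) (c : Set (Fin m) → Fin 4) (i : Fin 4) :
    encA m {S | ∀ T ∈ N, c T = i → ¬ S ⊆ T} = memN m (downMask4 m (N.image encS) (fun x => c (SahiC3Cube.pt m x)) i) := by
  refine Nat.eq_of_testBit_eq fun x => ?_
  rw [testBit_encA, testBit_memN, testBit_downMask4]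
  by_cases hx : x < 2 ^ m
  · have hiff : (SahiC3Cube.pt m x ∈ {S : Set (Fin m) | ∀ T ∈ N, c T = i → ¬ S ⊆ T}) ↔
        ¬ (∃ t ∈ N.image encS, c (SahiC3Cube.pt m t) = i ∧ x &&& t = x) := by
      rw [Set.mem_setOf_eq]
      constructor
      · rintro h ⟨t, ht, hct, hxt⟩
        obtain ⟨T, hT, rfl⟩ := mem_image.1 ht
        rw [pt_encS] at hct
        rw [land_eq_self_iff_pt_subset _ hx, pt_encS] at hxt
        exact h T hT hct hxt
      · intro h T hT hcT hsub
        refine h ⟨encS T, mem_image.2 ⟨T, hT, rfl⟩, ?_, ?_⟩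
        · rw [pt_encS]; exact hcT
        · rw [land_eq_self_iff_pt_subset _ hx, pt_encS]; exact hsub
    simp only [hx, decide_true, Bool.true_and]
    by_cases hq : ∃ t ∈ N.image encS, c (SahiC3Cube.pt m t) = i ∧ x &&& t = x
    · rw [decide_eq_true hq]
      simp only [Bool.not_true, decide_eq_false_iff_not]
      exact fun h => (hiff.1 h) hq
    · rw [decide_eq_false hq]
      simp only [Bool.not_false, decide_eq_true_eq]
      exact hiff.2 hq
  · simp [hx]

/-- A co-generated member is an increasing event. [this work] -/
theorem isUpperSet_coMember4 {m : ℕ} (N : Finset (Set (Fin m))) (c : Set (Fin m) → Fin 4) (i : Fin 4) :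
    IsUpperSet {S : Set (Fin m) | ∀ T ∈ N, c T = i → ¬ S ⊆ T} := by
  intro S S' hle hS T hT hcT hsub
  exact hS T hT hcT (le_trans hle hsub)

/-- An empty colour class generates the whole cube. [this work] -/
theorem coMember4_eq_univ_of_downMask4_eq_zero {m : ℕ} (N : Finset (Set (Fin m))) (c : Set (Fin m) → Fin 4) (i : Fin 4)
    (h : downMask4 m (N.image encS) (fun x => c (SahiC3Cube.pt m x)) i = 0) :
    {S : Set (Fin m) | ∀ T ∈ N, c T = i → ¬ S ⊆ T} = Set.univ := by
  refine Set.eq_univ_of_forall fun S T hT hcT hsub => ?_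
  have hbit := congrArg (fun n => Nat.testBit n (encS S)) h
  simp only [Nat.zero_testBit, testBit_downMask4, encS_lt S, decide_true, Bool.true_and, decide_eq_false_iff_not] at hbit
  refine hbit ⟨encS T, mem_image.2 ⟨T, hT, rfl⟩, ?_, ?_⟩
  · rw [pt_encS]; exact hcT
  · rw [land_eq_self_iff_pt_subset _ (encS_lt S), pt_encS, pt_encS]; exact hsub

/-- **A passing leaf gives `E₄ ≥ 0` on the co-generated quadruple** (every product measure; `C₃(μ_p)` on the cube is used for the leaves with an
empty colour class, through `E₄(·,·,·,Ω) = 2E₃`). [this work] -/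
theorem sahiE4_coMember_nonneg_of_leafT4 {m σ : ℕ} (hσ : 0 < σ) (hbnd : 24 * 16 ^ m < 2 ^ (σ - 1)) (p : Fin m → unitInterval)
    (hC3 : ∀ {A B C : Set (Set (Fin m))}, IsUpperSet A → IsUpperSet B → IsUpperSet C → 0 ≤ sahiE3 (prodBernoulli p) A B C)
    (N : Finset (Set (Fin m))) (c : Set (Fin m) → Fin 4)
    (hleaf : leafT4 σ m (krT5 σ m (fullN m)) (offM σ m) (offM σ m).toNat (downMask4 m (N.image encS) (fun x => c (SahiC3Cube.pt m x)) 0)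
      (downMask4 m (N.image encS) (fun x => c (SahiC3Cube.pt m x)) 1) (downMask4 m (N.image encS) (fun x => c (SahiC3Cube.pt m x)) 2)
      (downMask4 m (N.image encS) (fun x => c (SahiC3Cube.pt m x)) 3) = true) :
    0 ≤ sahiE4 (prodBernoulli p) {S | ∀ T ∈ N, c T = 0 → ¬ S ⊆ T} {S | ∀ T ∈ N, c T = 1 → ¬ S ⊆ T}
      {S | ∀ T ∈ N, c T = 2 → ¬ S ⊆ T} {S | ∀ T ∈ N, c T = 3 → ¬ S ⊆ T} := by
  have hU : ∀ i : Fin 4, IsUpperSet {S : Set (Fin m) | ∀ T ∈ N, c T = i → ¬ S ⊆ T} := isUpperSet_coMember4 N c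
  unfold leafT4 at hleaf
  rw [Bool.or_eq_true, decide_eq_true_eq] at hleaf
  rcases hleaf with hzero | hdig
  · -- an empty colour class: the member is `univ`, `E₄ = 2E₃ ≥ 0`
    rcases hzero with h | h | h | h
    · rw [coMember4_eq_univ_of_downMask4_eq_zero N c 0 h, sahiE4_comm₁₂, sahiE4_comm₂₃, sahiE4_comm₃₄, sahiE4_univ]
      exact mul_nonneg (by norm_num) (hC3 (hU 1) (hU 2) (hU 3))
    · rw [coMember4_eq_univ_of_downMask4_eq_zero N c 1 h, sahiE4_comm₂₃, sahiE4_comm₃₄, sahiE4_univ]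
      exact mul_nonneg (by norm_num) (hC3 (hU 0) (hU 2) (hU 3))
    · rw [coMember4_eq_univ_of_downMask4_eq_zero N c 2 h, sahiE4_comm₃₄, sahiE4_univ]
      exact mul_nonneg (by norm_num) (hC3 (hU 0) (hU 1) (hU 3))
    · rw [coMember4_eq_univ_of_downMask4_eq_zero N c 3 h, sahiE4_univ]
      exact mul_nonneg (by norm_num) (hC3 (hU 0) (hU 1) (hU 2))
  · -- the digit test
    rw [checkQuadH_eq, ← encA_colourMember4 N c 0, ← encA_colourMember4 N c 1, ← encA_colourMember4 N c 2,
      ← encA_colourMember4 N c 3] at hdig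
    refine sahiE4_nonneg_of_checkQuad (σ := σ) p ?_
    unfold checkQuad
    simp only [Bool.and_eq_true, decide_eq_true_eq]
    exact ⟨⟨hσ, hbnd⟩, hdig⟩

/-- **The coloured-antichain core of `C₄(μ_p)` from the check** (weight form, the hypothesis of `SahiAbsorbed.sahiPositive_of_colouring` at
order `4`): for every antichain `N` of `Set (Fin m)` and every 4-colouring `c`, `0 ≤ E₄(1_{U_0}, …, 1_{U_3})` for the co-generated family, under
the product weight `bernoulliWeight p` — given `colourCheck4 m σ = true` and `C₃(μ_p)` on the cube.  (Relabel by the `π` of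
`leafT4_of_colourCheck4` using the symmetry `sahiE_comp_perm`, then `sahiE4_coMember_nonneg_of_leafT4` and `sahiE_four_ind`.) [this work] -/
theorem sahiE_four_colouring_nonneg_of_colourCheck4 {m σ : ℕ} (h : colourCheck4 m σ = true) (p : Fin m → unitInterval)
    (hC3 : ∀ {A B C : Set (Set (Fin m))}, IsUpperSet A → IsUpperSet B → IsUpperSet C → 0 ≤ sahiE3 (prodBernoulli p) A B C)
    (N : Finset (Set (Fin m))) (c : Set (Fin m) → Fin 4) (hN : IsAntichain (· ≤ ·) (N : Set (Set (Fin m)))) :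
    0 ≤ sahiE (bernoulliWeight p) 4 (fun i => setInd (univ.filter fun q : Set (Fin m) => ∀ T ∈ N, c T = i → ¬ q ≤ T)) := by
  have h' := h
  unfold colourCheck4 at h'
  simp only [Bool.and_eq_true, decide_eq_true_eq] at h'
  obtain ⟨⟨hσ, hbnd⟩, -⟩ := h'
  -- the point set of `N`
  have hE : ∀ x ∈ N.image encS, x < 2 ^ m := by
    intro x hx
    obtain ⟨T, -, rfl⟩ := mem_image.1 hx
    exact encS_lt T
  have hanti : ∀ x ∈ N.image encS, ∀ y ∈ N.image encS, x ≠ y → x &&& y ≠ x := by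
    intro x hx y hy hxy hland
    obtain ⟨T, hT, rfl⟩ := mem_image.1 hx
    obtain ⟨T', hT', rfl⟩ := mem_image.1 hy
    have hsub : T ⊆ T' := by
      have := (land_eq_self_iff_pt_subset (encS T') (encS_lt T)).1 hland
      rwa [pt_encS, pt_encS] at this
    have hne : T ≠ T' := fun h => hxy (by rw [h])
    exact hN (mem_coe.2 hT) (mem_coe.2 hT') hne hsub
  -- the relabelling
  obtain ⟨π, hleaf⟩ := leafT4_of_colourCheck4 h (N.image encS) (fun x => c (SahiC3Cube.pt m x)) hE hanti
  have hev := sahiE4_coMember_nonneg_of_leafT4 hσ hbnd p hC3 N (fun T => π (c T)) hleaf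
  -- the family of `c` is the family of `π ∘ c` read through `π`
  set G : Fin 4 → Set (Fin m) → ℝ := fun k => setInd (univ.filter fun q : Set (Fin m) => ∀ T ∈ N, π (c T) = k → ¬ q ≤ T) with hG
  have hFG : (fun i => setInd (univ.filter fun q : Set (Fin m) => ∀ T ∈ N, c T = i → ¬ q ≤ T)) = fun i => G (π i) := by
    funext i
    simp only [hG]
    congr 1
    ext q
    simp only [mem_filter, mem_univ, true_and]
    constructor
    · intro hq T hT hcT; exact hq T hT (π.injective hcT)
    · intro hq T hT hcT; exact hq T hT (by rw [hcT])
  rw [hFG, sahiE_comp_perm (bernoulliWeight p) 4 π G]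
  have hGind : G = ![ind {S : Set (Fin m) | ∀ T ∈ N, π (c T) = 0 → ¬ S ⊆ T}, ind {S | ∀ T ∈ N, π (c T) = 1 → ¬ S ⊆ T},
      ind {S | ∀ T ∈ N, π (c T) = 2 → ¬ S ⊆ T}, ind {S | ∀ T ∈ N, π (c T) = 3 → ¬ S ⊆ T}] := by
    funext i ω
    fin_cases i <;> simp [hG, setInd_apply, ind]
  rw [hGind, sahiE_four_ind]
  exact hev

/-- `C₃(μ_p)` on events gives order-`3` Sahi positivity of the product weight (layer cake). [this work] -/
theorem sahiPositive_three_of_events {m : ℕ} (p : Fin m → unitInterval)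
    (hC3 : ∀ {A B C : Set (Set (Fin m))}, IsUpperSet A → IsUpperSet B → IsUpperSet C → 0 ≤ sahiE3 (prodBernoulli p) A B C) :
    SahiPositive (bernoulliWeight p) 3 := by
  classical
  rw [sahiPositive_iff_indicators]
  intro U hU
  have hind : (fun i => setInd (U i)) =
      ![ind (U 0 : Set (Set (Fin m))), ind (U 1 : Set (Set (Fin m))), ind (U 2 : Set (Set (Fin m)))] := by
    funext i ω
    fin_cases i <;> simp [setInd_apply, ind]
  rw [hind, sahiE_three_ind]
  exact hC3 (fun a b hab ha => hU 0 hab ha) (fun a b hab ha => hU 1 hab ha) (fun a b hab ha => hU 2 hab ha)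

/-- **Order-`4` Sahi positivity of the product weight on `2^{Fin m}` from the coloured-antichain check and `C₃(μ_p)`** (function form;
value-level saturation `SahiAbsorbed.sahiPositive_of_colouring`). [this work] -/
theorem sahiPositive_four_of_colourCheck4 {m σ : ℕ} (h : colourCheck4 m σ = true) (p : Fin m → unitInterval)
    (hC3 : ∀ {A B C : Set (Set (Fin m))}, IsUpperSet A → IsUpperSet B → IsUpperSet C → 0 ≤ sahiE3 (prodBernoulli p) A B C) :
    SahiPositive (bernoulliWeight p) 4 := by
  classical
  refine SahiAbsorbed.sahiPositive_of_colouring (n := 2) (isFKGMeasure_bernoulliWeight p).nonneg (fun k hk1 hk2 => ?_)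
    (fun N c hN => sahiE_four_colouring_nonneg_of_colourCheck4 h p hC3 N c hN)
  interval_cases k
  · exact sahiPositive_one (isFKGMeasure_bernoulliWeight p).nonneg
  · exact sahiPositive_two (isFKGMeasure_bernoulliWeight p)
  · exact sahiPositive_three_of_events p hC3

/-- **SAHI'S `C₄` ON `{0,1}^m` FROM THE COLOURED-ANTICHAIN CHECK.**  If `colourCheck4 m σ = true` and `C₃` holds on the `m`-cube for the product
measure `prodBernoulli p`, then for all increasing `A, B, C, D ⊆ Set (Fin m)`:
`0 ≤ E₄(A,B,C,D) = 6μ(ABCD) − 2Σμ(A_i)μ(A_jA_kA_l) + Σμ(A_i)μ(A_j)μ(A_kA_l) − Σμ(A_iA_j)μ(A_kA_l) − μ(A)μ(B)μ(C)μ(D)`. [this work] -/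
theorem sahiE4_nonneg_of_colourCheck4 {m σ : ℕ} (h : colourCheck4 m σ = true) (p : Fin m → unitInterval)
    (hC3 : ∀ {A B C : Set (Set (Fin m))}, IsUpperSet A → IsUpperSet B → IsUpperSet C → 0 ≤ sahiE3 (prodBernoulli p) A B C)
    {A B C D : Set (Set (Fin m))} (hA : IsUpperSet A) (hB : IsUpperSet B) (hC : IsUpperSet C) (hD : IsUpperSet D) :
    0 ≤ sahiE4 (prodBernoulli p) A B C D := by
  rw [← sahiE_four_ind]
  refine sahiPositive_four_of_colourCheck4 h p hC3 _ (fun i x => ?_) (fun i => ?_)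
  · fin_cases i <;> exact ind_nonneg _ _
  · fin_cases i
    · exact monotone_ind_of_isUpperSet hA
    · exact monotone_ind_of_isUpperSet hB
    · exact monotone_ind_of_isUpperSet hC
    · exact monotone_ind_of_isUpperSet hD

end Events

end Summit.CriticalPhenomena.PercolationContinuityZ3.Theorems.SahiC4Cube
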